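import Literature.Topology.FourManifolds.EntranceTransitionDet
import Literature.Topology.FourManifolds.TracePolarTwist

/-!
# Twisting the second datum of a couple by planar reflections of its Milnor boxes

Topic `Literature/Topology/FourManifolds` (support of `stmt-SmoothPoincare4-15190`, structure
conjugacy; step (ε1) of the construction of the sphere diffeomorphism).  Everything here is
**proved**.

Milnor coordinates about an index-`1` saddle are unique only up to the symmetries
`diag(±1, O(2))` of the model (`MilnorBoxTwist.lean`).  Reflecting the second planar coordinate,
`boxSign false b : (x₁, y₁, y₂) ↦ (x₁, y₁, ∓y₂)` (`TracePolarTwist.lean`), of the boxes of chosen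
saddles of the second datum of a couple changes the entrance charts by the planar reflection
`planeRefl b` and hence **reverses the sign of the Jacobian of the planar transition map** at
those saddles:

* `BasinPair.SaddleData.twistA a b` — saddle data with the `A`-boxes twisted (companion of
  `twistB`); `entW_twistA`, `entDir_twistA`, `coreDir_twistA`, `entOf_twistA`, `entBack_twistA`;
* `BasinCouple.SaddleData.twistQB bf` — the couple data with the boxes of `B` reflected at the
  saddles `s'` with `bf s' = true`; `tPlanar_twistQB : tPlanar' = planeRefl (bf (σ s)) ∘ tPlanar`,
  `det_fderiv_tPlanar_twistQB`.

## References

* J. Milnor, *Lectures on the h-cobordism theorem* (1965), Def. 3.1 (2) (PDF p. 12).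
  [MilnorHCobordism1965]
-/

open scoped Manifold ContDiff Topology
open Set Function Filter Metric Module

noncomputable section

namespace Literature.Topology.FourManifolds

open Cobordism FourManifolds.Flow TracePolar

universe u

/-! ### The planar reflection as a linear map and its determinant -/

namespace TracePolar

/-- Local notation for the model plane and space. -/
local notation "E2" => EuclideanSpace ℝ (Fin 2)
local notation "E3" => EuclideanSpace ℝ (Fin 3)

/-- The planar reflection as a continuous linear equivalence. [folklore] -/
def planeReflL (b : Bool) : E2 ≃L[ℝ] E2 := (signDiag ![true, !b]).toContinuousLinearEquiv

/-- `planeReflL` is `planeRefl`. [folklore] -/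
@[simp] theorem planeReflL_apply (b : Bool) (w : E2) : planeReflL b w = planeRefl b w := rfl

/-- **The determinant of the planar reflection**: `-1` for `b = true`, `1` for `b = false`. [folklore] -/
theorem det_planeReflL (b : Bool) :
    LinearMap.det ((planeReflL b : E2 →L[ℝ] E2) : E2 →ₗ[ℝ] E2) = boolSign (!b) := by
  have h : ((planeReflL b : E2 →L[ℝ] E2) : E2 →ₗ[ℝ] E2) =
      Matrix.toLin (EuclideanSpace.basisFun (Fin 2) ℝ).toBasis (EuclideanSpace.basisFun (Fin 2) ℝ).toBasis
        (Matrix.diagonal ![1, boolSign (!b)]) := by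
    apply (EuclideanSpace.basisFun (Fin 2) ℝ).toBasis.ext
    intro i
    rw [Matrix.toLin_self]
    fin_cases i
    · ext j; fin_cases j <;> simp [planeRefl, signDiag, Matrix.diagonal]
    · ext j; fin_cases j <;> simp [planeRefl, signDiag, Matrix.diagonal]
  rw [h, LinearMap.det_toLin, Matrix.det_diagonal]
  simp [Fin.prod_univ_two]

/-- `yv ∘ boxSign false b = planeRefl b ∘ yv`. [folklore] -/
theorem yv_boxSign_false (b : Bool) (u : E3) : yv (boxSign false b u) = planeRefl b (yv u) := by
  have hu : u = mk3 (u 0) (yv u) := (mk3_zero_yv u).symm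
  conv_lhs => rw [hu, boxSign_mk3]
  rw [yv_mk3]

/-- `boxSign false b` acts on entrance-sheet points through `planeRefl b`. [folklore] -/
theorem boxSign_false_entPoint (ε : ℝ) (b b' : Bool) (y : E2) :
    boxSign false b (entPoint ε b' y) = entPoint ε b' (planeRefl b y) := by
  rw [entPoint, boxSign_mk3, entPoint, norm_planeRefl]
  simp [boolSign]

end TracePolar

/-! ### Saddle data with the `A`-boxes twisted -/

namespace BasinPair.SaddleData

variable {W : Type u} [TopologicalSpace W] [T2Space W] [SecondCountableTopology W]
  [CompactSpace W] [ChartedSpace (EuclideanHalfSpace (2 + 1)) W] [IsManifold (𝓡∂ (2 + 1)) ∞ W]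
  {g : W → ℝ} {ξA ξB : Π x : W, TangentSpace (𝓡∂ (2 + 1)) x} {P : BasinPair g ξA ξB} (Q : P.SaddleData)

/-- Local notation for the model plane and space. -/
local notation "E2" => EuclideanSpace ℝ (Fin 2)
local notation "E3" => EuclideanSpace ℝ (Fin 3)

/-- The interiority hypothesis of `MilnorBox.twist` for the `A`-boxes. [folklore] -/
theorem intA' (s' : SaddlePt 2 g) :
    closedBall ((Q.DA s').chart.extend (𝓡∂ (2 + 1)) s'.1) (3 * (Q.DA s').ε) ⊆ interior (range (𝓡∂ (2 + 1))) := by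
  rw [Q.εA]; exact Q.intA s'

/-- The symmetry hypothesis of `MilnorBox.twist` for the sign changes of the `A`-boxes. [folklore] -/
theorem hSA (a b : SaddlePt 2 g → Bool) (s' : SaddlePt 2 g) (u : E3) :
    boxSign (a s') (b s') (milnorModelField (Q.DA s').k u) = milnorModelField (Q.DA s').k (boxSign (a s') (b s') u) :=
  signDiag_milnorModelField _ _ u

/-- **Saddle data with the `A`-boxes twisted by sign changes** `boxSign (a s') (b s')`. [cite: MilnorHCobordism1965, Def. 3.1 (2) (PDF p. 12)] -/
def twistA (a b : SaddlePt 2 g → Bool) : P.SaddleData where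
  c := Q.c
  apply_eq_c := Q.apply_eq_c
  ε := Q.ε
  ε_pos := Q.ε_pos
  DA s' := (Q.DA s').twist (boxSign (a s') (b s')) (Q.intA' s') (Q.hSA a b s')
  DB := Q.DB
  εA s' := by rw [MilnorBox.twist_ε]; exact Q.εA s'
  εB := Q.εB
  σ := Q.σ
  k_eq s := by rw [MilnorBox.twist_k]; exact Q.k_eq s
  sph_lt := Q.sph_lt
  lt_collar := Q.lt_collar
  intA s' := by rw [MilnorBox.center_twist]; exact Q.intA s'
  intB := Q.intB
  disjA s₁ s₂ h := (Q.disjA s₁ s₂ h).mono (MilnorBox.twistChart_source_subset _ _) (MilnorBox.twistChart_source_subset _ _)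
  disjB := Q.disjB

variable (a b : SaddlePt 2 g → Bool)

/-- `twistA_σ`. [folklore] -/
@[simp] theorem twistA_σ : (Q.twistA a b).σ = Q.σ := rfl
/-- `twistA_ε`. [folklore] -/
@[simp] theorem twistA_ε : (Q.twistA a b).ε = Q.ε := rfl
/-- `twistA_c`. [folklore] -/
@[simp] theorem twistA_c : (Q.twistA a b).c = Q.c := rfl
/-- `twistA_DA`. [folklore] -/
theorem twistA_DA (s' : SaddlePt 2 g) : (Q.twistA a b).DA s' = (Q.DA s').twist (boxSign (a s') (b s')) (Q.intA' s') (Q.hSA a b s') := rfl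
/-- The index of the twisted `A`-boxes. [folklore] -/
@[simp] theorem twistA_DA_k (s' : SaddlePt 2 g) : ((Q.twistA a b).DA s').k = (Q.DA s').k := rfl
/-- `twistA_entLevel`. [folklore] -/
@[simp] theorem twistA_entLevel : (Q.twistA a b).entLevel = Q.entLevel := rfl

/-- The coordinates of the twisted `A`-boxes on their sources. [folklore] -/
theorem coord_twistA_DA {s' : SaddlePt 2 g} {z : W} (hz : z ∈ ((Q.twistA a b).DA s').chart.source) :
    ((Q.twistA a b).DA s').coord z = boxSign (a s') (b s') ((Q.DA s').coord z) :=
  MilnorBox.coord_twist (Q.DA s') _ (Q.intA' s') (Q.hSA a b s') hz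

/-- The chart points of the twisted `A`-boxes: `pt' w = pt (boxSign w)`. [folklore] -/
theorem twistA_pt {s' : SaddlePt 2 g} {w : E3} (hw : ‖w‖ ≤ 3 * Q.ε) :
    ((Q.twistA a b).DA s').pt w = (Q.DA s').pt (boxSign (a s') (b s') w) := by
  have hw' : ‖w‖ ≤ 3 * (Q.DA s').ε := by rw [Q.εA]; exact hw
  have h := MilnorBox.twist_symm_add (Q.DA s') (boxSign (a s') (b s')) (Q.intA' s') (Q.hSA a b s') hw'
  rw [boxSign_symm_apply] at h
  exact h

variable {a b} {s : SaddlePt 2 g} {b' : Bool} {y : E2}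

/-- **The entrance points of the twisted data** (no `x₁`-flip): `entW' s b' y = entW s b' (planeRefl (b s) y)`. [folklore] -/
theorem entW_twistA (hy : ‖y‖ ^ 2 < Q.ε ^ 2) (s : SaddlePt 2 g) (b' : Bool) :
    (Q.twistA (fun _ => false) b).entW s b' y = Q.entW s b' (planeRefl (b s) y) := by
  show ((Q.twistA (fun _ => false) b).DA s).pt (entPoint Q.ε b' y) = (Q.DA s).pt (entPoint Q.ε b' (planeRefl (b s) y))
  rw [Q.twistA_pt _ _ (norm_entPoint_lt Q.ε_pos b' hy).le, boxSign_false_entPoint]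

/-- The entrance directions of the twisted data. [folklore] -/
theorem entDir_twistA (hy : ‖y‖ ^ 2 < Q.ε ^ 2) (s : SaddlePt 2 g) (b' : Bool) :
    (Q.twistA (fun _ => false) b).entDir s b' y = Q.entDir s b' (planeRefl (b s) y) := by
  rw [entDir, Q.entW_twistA hy, entDir]

/-- The core directions are unchanged. [folklore] -/
theorem coreDir_twistA (s : SaddlePt 2 g) (b' : Bool) : (Q.twistA (fun _ => false) b).coreDir s b' = Q.coreDir s b' := by
  rw [coreDir, Q.entDir_twistA (by rw [norm_zero]; simpa using Q.sq_pos), coreDir]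
  congr 1
  exact map_zero (signDiag ![true, !(b s)])

/-- `entOf` is unchanged. [folklore] -/
@[simp] theorem entOf_twistA (u : E3) : (Q.twistA a b).entOf u = Q.entOf u := rfl

/-- **The inverse entrance chart of the twisted data**: `entBack' s u = planeRefl (b s) (entBack s u)` on the chart source. [folklore] -/
theorem entBack_twistA {u : E3} (hu : Q.entOf u ∈ (Q.DA s).chart.source)
    (hu' : ‖(Q.DA s).coord (Q.entOf u)‖ ≤ 3 * Q.ε) :
    (Q.twistA (fun _ => false) b).entBack s u = planeRefl (b s) (Q.entBack s u) := by
  rw [entBack_def, entOf_twistA, entBack_def]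
  have hz : Q.entOf u ∈ ((Q.twistA (fun _ => false) b).DA s).chart.source := by
    have hw : ‖(Q.DA s).coord (Q.entOf u)‖ ≤ 3 * (Q.DA s).ε := by rw [Q.εA]; exact hu'
    have h := MilnorBox.symm_add_mem_twist_source (Q.DA s) (boxSign false (b s)) (Q.intA' s) (Q.hSA (fun _ => false) b s) hw
    have hpt : ((Q.DA s).chart.extend (𝓡∂ (2 + 1))).symm ((Q.DA s).center + (Q.DA s).coord (Q.entOf u)) = Q.entOf u :=
      (Q.DA s).pt_coord_of_mem_chartBall (R := ‖(Q.DA s).coord (Q.entOf u)‖ + 1) ⟨hu, by linarith⟩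
    rw [hpt] at h
    exact h
  rw [Q.coord_twistA_DA _ _ hz, yv_boxSign_false]

end BasinPair.SaddleData

/-! ### The couple with the boxes of `B` reflected -/

namespace BasinCouple.SaddleData

attribute [local instance] fact_finrank_euclideanSpace_succ

variable {W : Type u} [TopologicalSpace W] [T2Space W] [SecondCountableTopology W]
  [CompactSpace W] [ChartedSpace (EuclideanHalfSpace (2 + 1)) W] [IsManifold (𝓡∂ (2 + 1)) ∞ W]
  {gA gB : W → ℝ} {ξA ξB : Π x : W, TangentSpace (𝓡∂ (2 + 1)) x} {C : BasinCouple gA gB ξA ξB}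
  (Q : C.SaddleData)

/-- Local notation for the model plane and space. -/
local notation "E2" => EuclideanSpace ℝ (Fin 2)
local notation "E3" => EuclideanSpace ℝ (Fin 3)

/-- **The couple data with the boxes of `B` reflected** (`y₂ ↦ -y₂`) at the saddles `s'` with
`bf s' = true`. [cite: MilnorHCobordism1965, Def. 3.1 (2) (PDF p. 12)] -/
def twistQB (bf : SaddlePt 2 gB → Bool) : C.SaddleData where
  QA := Q.QA
  QB := Q.QB.twistA (fun _ => false) bf
  ε_eq := Q.ε_eq
  σ := Q.σ
  k_eq s := Q.k_eq s

variable (bf : SaddlePt 2 gB → Bool)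

/-- `twistQB_QA`. [folklore] -/
@[simp] theorem twistQB_QA : (Q.twistQB bf).QA = Q.QA := rfl
/-- `twistQB_QB`. [folklore] -/
theorem twistQB_QB : (Q.twistQB bf).QB = Q.QB.twistA (fun _ => false) bf := rfl
/-- `twistQB_σ`. [folklore] -/
@[simp] theorem twistQB_σ : (Q.twistQB bf).σ = Q.σ := rfl

variable {Q bf} {s : SaddlePt 2 gA} {φ : Metric.sphere (0 : E3) 1 ≃ₘ⟮𝓡 2, 𝓡 2⟯ Metric.sphere (0 : E3) 1}

/-- `coneU` is unchanged by the twist. [folklore] -/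
@[simp] theorem coneU_twistQB (b : Bool) (y : E2) : (Q.twistQB bf).coneU φ s b y = Q.coneU φ s b y := rfl

/-- The core directions of `B` are unchanged by the twist. [folklore] -/
theorem coreDir_twistQB (s' : SaddlePt 2 gB) (b : Bool) : (Q.twistQB bf).QB.coreDir s' b = Q.QB.coreDir s' b :=
  Q.QB.coreDir_twistA s' b

variable (hkA : ∀ s, (Q.QA.DA s).k = 1) (hkB : ∀ s', (Q.QB.DA s').k = 1)
  (hφ0 : ∀ b, (φ (unitVec (Q.QA.coreDir s b)) : E3) = C.A.rad⁻¹ • Q.QB.coreDir (Q.σ s) b)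

include hkA hkB hφ0 in
/-- **The planar transition of the twisted couple is the reflected planar transition** near `0`. [folklore] -/
theorem tPlanar_twistQB_eventuallyEq (b : Bool) :
    (Q.twistQB bf).tPlanar φ s b =ᶠ[𝓝 (0 : E2)] (planeRefl (bf (Q.σ s)) ∘ Q.tPlanar φ s b) := by
  filter_upwards [Q.eventually_coneU_mem_entDom hkA hkB hφ0 b] with y hy
  obtain ⟨-, hmem⟩ := hy
  rw [tPlanar_def, coneU_twistQB, twistQB_QB, comp_apply, tPlanar_def]
  show (Q.QB.twistA (fun _ => false) bf).entBack (Q.σ s) (Q.coneU φ s b y) = _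
  have hU := hmem.2.2.2.1
  exact Q.QB.entBack_twistA hU.1.1 (le_of_lt hU.1.2)

include hkA hkB hφ0 in
/-- **The Jacobian of the planar transition of the twisted couple**: `det` is multiplied by `∓1`. [folklore] -/
theorem det_fderiv_tPlanar_twistQB (b : Bool)
    (hd : DifferentiableAt ℝ (Q.tPlanar φ s b) 0) :
    LinearMap.det ((fderiv ℝ ((Q.twistQB bf).tPlanar φ s b) 0 : E2 →L[ℝ] E2) : E2 →ₗ[ℝ] E2) =
      boolSign (!bf (Q.σ s)) * LinearMap.det ((fderiv ℝ (Q.tPlanar φ s b) 0 : E2 →L[ℝ] E2) : E2 →ₗ[ℝ] E2) := by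
  have h1 : HasFDerivAt (planeRefl (bf (Q.σ s)) ∘ Q.tPlanar φ s b)
      (((planeReflL (bf (Q.σ s)) : E2 →L[ℝ] E2)).comp (fderiv ℝ (Q.tPlanar φ s b) 0)) 0 :=
    ((planeReflL (bf (Q.σ s)) : E2 →L[ℝ] E2).hasFDerivAt).comp 0 hd.hasFDerivAt
  have h2 := h1.congr_of_eventuallyEq (Q.tPlanar_twistQB_eventuallyEq hkA hkB hφ0 b)
  rw [h2.fderiv]
  show LinearMap.det (((planeReflL (bf (Q.σ s)) : E2 →L[ℝ] E2) : E2 →ₗ[ℝ] E2).comp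
    ((fderiv ℝ (Q.tPlanar φ s b) 0 : E2 →L[ℝ] E2) : E2 →ₗ[ℝ] E2)) = _
  rw [LinearMap.det_comp, det_planeReflL]

end BasinCouple.SaddleData

end Literature.Topology.FourManifolds
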